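import Summits.Ventures.PackingBounds.Configurations.LeechSectionCount
import Summits.Ventures.PackingBounds.Configurations.SubspaceTransfer
import Summits.Ventures.PackingBounds.Kissing.DimensionTwentyOne
import Summits.Ventures.PackingBounds.Kissing.DimensionTwentyTwo
import Summits.Ventures.PackingBounds.Kissing.DimensionTwentyThree

/-!
# Kissing configurations of `Λ₂₃, Λ₂₂, Λ₂₁` from the Leech lattice: `κ(23) ≥ 93150`, `κ(22) ≥ 49896`, `κ(21) ≥ 27720`

Framing: lottery ticket; floor = certified bounds/negative ranges. Venture `PackingBounds` (cell
`pub-packcert`, seat `pub-packcert-energy`).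

The sections `sec23 ⊃ sec22 ⊃ sec21` of the Leech minimal vectors (`LeechSectionCount.lean`: `93150`,
`49896`, `27720` vectors, counted structurally) are orthogonal to `1`, `2`, `3` pairwise-orthogonal integer
vectors (`x₀ = (4,4,0,…)`; `x₀, (4,-4,8,0,…)`; `x₀, (-4,4,8,0,…), (8,-8,8,24,0,…)` — orthogonalised bases of
the `A₁, A₂, A₃` root sublattices), so after normalisation they are kissing configurations of
`x₀^⊥ ≅ ℝ²³`, `ℝ²²`, `ℝ²¹` (`Config.exists_transfer_orthogonal`). These are the kissing configurations of the
laminated lattices `Λ₂₃, Λ₂₂, Λ₂₁` (Leech 1967) and give the lower bounds **`κ(23) ≥ 93150`,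
`κ(22) ≥ 49896`, `κ(21) ≥ 27720`** as kernel-checked theorems — for `d = 22, 23` still the best lower bounds
known [Conway–Sloane, Table 1.2; Cohn–Li 2024, Table 1]; for `d = 21` superseded by Cohn–Li's `29768`
(arXiv:2411.04916, 2024; odd-sign modification of this very section). With the cell's Delsarte LP certificates
they give the two-sided brackets `27720 ≤ κ(21) ≤ 56851`, `49896 ≤ κ(22) ≤ 86537`, `93150 ≤ κ(23) ≤ 128095`
in Lean.

## References
* J. H. Conway, N. J. A. Sloane, *Sphere Packings, Lattices and Groups*, Ch. 1 Table 1.2, Ch. 6 Table 6.1. [`ConwaySloane1999`]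
-/

namespace Summit.Ventures.PackingBounds.Config.Leech

open Finset Golay

/-! ### Normal vectors -/

/-- `(4,-4,8,0,…)`: with `x₀` an orthogonal basis of the `A₂`-plane `⟨x₀, x₁⟩`. -/
def w22 : Fin 24 → ℤ := fun j => if j = 0 then 4 else if j = 1 then -4 else if j = 2 then 8 else 0

/-- `(-4,4,8,0,…)`: second vector of an orthogonal basis of the `A₃`-space `⟨x₀, z₁, z₂⟩`. -/
def w21a : Fin 24 → ℤ := fun j => if j = 0 then -4 else if j = 1 then 4 else if j = 2 then 8 else 0

/-- `(8,-8,8,24,0,…)`: third vector of an orthogonal basis of the `A₃`-space `⟨x₀, z₁, z₂⟩`. -/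
def w21b : Fin 24 → ℤ :=
  fun j => if j = 0 then 8 else if j = 1 then -8 else if j = 2 then 8 else if j = 3 then 24 else 0

/-- Testing against `w22`. -/
theorem ip_w22 (y : Fin 24 → ℤ) : ip w22 y = 4 * y 0 - 4 * y 1 + 8 * y 2 := by
  simp [ip, w22, Fin.sum_univ_succ]; ring

/-- Testing against `w21a`. -/
theorem ip_w21a (y : Fin 24 → ℤ) : ip w21a y = -4 * y 0 + 4 * y 1 + 8 * y 2 := by
  simp [ip, w21a, Fin.sum_univ_succ]; ring

/-- Testing against `w21b`. -/
theorem ip_w21b (y : Fin 24 → ℤ) : ip w21b y = 8 * y 0 - 8 * y 1 + 8 * y 2 + 24 * y 3 := by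
  simp [ip, w21b, Fin.sum_univ_succ]; ring

/-- `toE 32 w ≠ 0` for an integer vector of positive norm. -/
theorem toE_ne_zero {w : Fin 24 → ℤ} (h : 0 < ip w w) : toE 32 w ≠ 0 := by
  intro h0
  have hi := inner_toE (q := 32) (by norm_num) w w
  rw [h0, inner_zero_left] at hi
  have : (0 : ℝ) < (ip w w : ℝ) / 32 := by positivity
  linarith

/-- Orthogonality of normals through `toE`. -/
theorem inner_toE_eq_zero {w w' : Fin 24 → ℤ} (h : ip w w' = 0) : inner ℝ (toE 32 w) (toE 32 w') = 0 := by
  rw [inner_toE (by norm_num), h]; simp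

/-! ### Images of sections under `toE 32` -/

/-- The normalised image of a set of Leech minimal vectors consists of unit vectors. -/
theorem norm_image_toE {S : Finset (Fin 24 → ℤ)} (hS : S ⊆ leechInt) : ∀ x ∈ S.image (toE 32), ‖x‖ = 1 := by
  intro x hx
  obtain ⟨v, hv, rfl⟩ := mem_image.mp hx
  exact norm_toE (by norm_num) (by rw [ip_self_of_mem (hS hv)]; norm_num)

/-- … with pairwise inner products `≤ 1/2`. -/
theorem inner_image_toE {S : Finset (Fin 24 → ℤ)} (hS : S ⊆ leechInt) :
    ∀ x ∈ S.image (toE 32), ∀ y ∈ S.image (toE 32), x ≠ y → inner ℝ x y ≤ 1 / 2 := by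
  intro x hx y hy hxy
  obtain ⟨v, hv, rfl⟩ := mem_image.mp hx
  obtain ⟨w, hw, rfl⟩ := mem_image.mp hy
  have hvw : v ≠ w := fun h => hxy (by rw [h])
  rw [inner_toE (by norm_num)]
  have h16 : (ip v w : ℝ) ≤ 16 := by exact_mod_cast ip_le_of_mem (hS hv) (hS hw) hvw
  rw [div_le_iff₀ (by norm_num)]
  linarith

/-- … and has the same cardinality. -/
theorem card_image_toE (S : Finset (Fin 24 → ℤ)) : (S.image (toE 32)).card = S.card :=
  card_image_of_injective _ (toE_injective (by norm_num))

/-- From an orthogonal transfer to a kissing configuration. -/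
theorem kissing_of_transfer {n : ℕ} {S : Finset (Fin 24 → ℤ)} (hS : S ⊆ leechInt)
    {C' : Finset (EuclideanSpace ℝ (Fin n))} (hc : C'.card = (S.image (toE 32)).card)
    (hn : ∀ x' ∈ C', ∃ x ∈ S.image (toE 32), ‖x'‖ = ‖x‖)
    (hi : ∀ x' ∈ C', ∀ y' ∈ C', x' ≠ y' → ∃ x ∈ S.image (toE 32), ∃ y ∈ S.image (toE 32), x ≠ y ∧
      inner ℝ x' y' = inner ℝ x y) :
    C'.card = S.card ∧ (∀ x ∈ C', ‖x‖ = 1) ∧ (∀ x ∈ C', ∀ y ∈ C', x ≠ y → inner ℝ x y ≤ 1 / 2) := by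
  refine ⟨by rw [hc, card_image_toE], fun x' hx' => ?_, fun x' hx' y' hy' hne => ?_⟩
  · obtain ⟨x, hx, he⟩ := hn x' hx'
    rw [he]; exact norm_image_toE hS x hx
  · obtain ⟨x, hx, y, hy, hxy, he⟩ := hi x' hx' y' hy' hne
    rw [he]; exact inner_image_toE hS x hx y hy hxy

/-! ### Dimension 23 -/

/-- Members of `sec23`. -/
theorem mem_sec23 {y : Fin 24 → ℤ} (hy : y ∈ sec23) : y ∈ leechInt ∧ y 0 + y 1 = 0 := by
  rw [sec23] at hy; simpa using hy

/-- **`κ(23) ≥ 93150`**: a kissing configuration of `93150` unit vectors in `ℝ²³` (the `Λ₂₃` kissing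
configuration, from the Leech lattice). [cite: ConwaySloane1999, Ch. 1 Table 1.2] -/
theorem exists_kissing_93150 : ∃ C : Finset (EuclideanSpace ℝ (Fin 23)),
    C.card = 93150 ∧ (∀ x ∈ C, ‖x‖ = 1) ∧ (∀ x ∈ C, ∀ y ∈ C, x ≠ y → inner ℝ x y ≤ 1 / 2) := by
  have hS : sec23 ⊆ leechInt := fun y hy => (mem_sec23 hy).1
  have horth : ∀ x ∈ sec23.image (toE 32), inner ℝ (toE 32 x0) x = 0 := by
    intro x hx
    obtain ⟨y, hy, rfl⟩ := mem_image.mp hx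
    exact inner_toE_eq_zero (by rw [ip_x0]; have := (mem_sec23 hy).2; omega)
  obtain ⟨C', hc, hn, hi, _⟩ := exists_transfer_orthogonal_singleton (n := 23) (toE 32 x0)
    (toE_ne_zero (by rw [ip_x0_x0]; norm_num)) (sec23.image (toE 32)) horth
  obtain ⟨h1, h2, h3⟩ := kissing_of_transfer hS hc hn hi
  exact ⟨C', by rw [h1, card_sec23], h2, h3⟩

/-- **`93150 ≤ κ(23) ≤ 128095` in Lean.** [cite: ConwaySloane1999, Ch. 1 Table 1.2] -/
theorem kissing_dim23_bracket :
    (∃ C : Finset (EuclideanSpace ℝ (Fin 23)), C.card = 93150 ∧ (∀ x ∈ C, ‖x‖ = 1) ∧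
      (∀ x ∈ C, ∀ y ∈ C, x ≠ y → inner ℝ x y ≤ 1 / 2)) ∧
    ∀ C : Finset (EuclideanSpace ℝ (Fin 23)), (∀ x ∈ C, ‖x‖ = 1) →
      (∀ x ∈ C, ∀ y ∈ C, x ≠ y → inner ℝ x y ≤ 1 / 2) → C.card ≤ 128095 :=
  ⟨exists_kissing_93150, Kissing.kissing_dim23_le_128095⟩

/-! ### Dimension 22 -/

/-- Members of `sec22`. -/
theorem mem_sec22 {y : Fin 24 → ℤ} (hy : y ∈ sec22) : y ∈ leechInt ∧ (y 0 + y 1 = 0 ∧ y 0 + y 2 = 0) := by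
  rw [sec22] at hy; simpa using hy

/-- **`κ(22) ≥ 49896`**: a kissing configuration of `49896` unit vectors in `ℝ²²` (the `Λ₂₂` kissing
configuration, from the Leech lattice). [cite: ConwaySloane1999, Ch. 1 Table 1.2] -/
theorem exists_kissing_49896 : ∃ C : Finset (EuclideanSpace ℝ (Fin 22)),
    C.card = 49896 ∧ (∀ x ∈ C, ‖x‖ = 1) ∧ (∀ x ∈ C, ∀ y ∈ C, x ≠ y → inner ℝ x y ≤ 1 / 2) := by
  have hS : sec22 ⊆ leechInt := fun y hy => (mem_sec22 hy).1
  let u : Fin 2 → EuclideanSpace ℝ (Fin 24) := ![toE 32 x0, toE 32 w22]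
  have hu : LinearIndependent ℝ u := by
    apply linearIndependent_of_ne_zero_of_inner_eq_zero
    · intro i
      fin_cases i
      · exact toE_ne_zero (by rw [ip_x0_x0]; norm_num)
      · exact toE_ne_zero (by decide)
    · intro i j hij
      fin_cases i <;> fin_cases j
      · exact absurd rfl hij
      · exact inner_toE_eq_zero (by decide)
      · exact inner_toE_eq_zero (by decide)
      · exact absurd rfl hij
  have horth : ∀ x ∈ sec22.image (toE 32), ∀ i, inner ℝ (u i) x = 0 := by
    intro x hx i
    obtain ⟨y, hy, rfl⟩ := mem_image.mp hx
    obtain ⟨_, h01, h02⟩ := mem_sec22 hy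
    fin_cases i
    · exact inner_toE_eq_zero (by rw [ip_x0]; omega)
    · exact inner_toE_eq_zero (by rw [ip_w22]; omega)
  obtain ⟨C', hc, hn, hi, _⟩ := exists_transfer_orthogonal (m := 24) (n := 22) (k := 2) rfl u hu
    (sec22.image (toE 32)) horth
  obtain ⟨h1, h2, h3⟩ := kissing_of_transfer hS hc hn hi
  exact ⟨C', by rw [h1, card_sec22], h2, h3⟩

/-- **`49896 ≤ κ(22) ≤ 86537` in Lean.** [cite: ConwaySloane1999, Ch. 1 Table 1.2] -/
theorem kissing_dim22_bracket :
    (∃ C : Finset (EuclideanSpace ℝ (Fin 22)), C.card = 49896 ∧ (∀ x ∈ C, ‖x‖ = 1) ∧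
      (∀ x ∈ C, ∀ y ∈ C, x ≠ y → inner ℝ x y ≤ 1 / 2)) ∧
    ∀ C : Finset (EuclideanSpace ℝ (Fin 22)), (∀ x ∈ C, ‖x‖ = 1) →
      (∀ x ∈ C, ∀ y ∈ C, x ≠ y → inner ℝ x y ≤ 1 / 2) → C.card ≤ 86537 :=
  ⟨exists_kissing_49896, Kissing.kissing_dim22_le_86537⟩

/-! ### Dimension 21 -/

/-- Members of `sec21`. -/
theorem mem_sec21 {y : Fin 24 → ℤ} (hy : y ∈ sec21) :
    y ∈ leechInt ∧ (y 0 + y 1 = 0 ∧ y 2 - y 0 = 0 ∧ y 3 - y 1 = 0) := by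
  rw [sec21] at hy; simpa using hy

/-- **`κ(21) ≥ 27720`**: a kissing configuration of `27720` unit vectors in `ℝ²¹` (the `Λ₂₁` kissing
configuration, from the Leech lattice). [cite: ConwaySloane1999, Ch. 1 Table 1.2] -/
theorem exists_kissing_27720 : ∃ C : Finset (EuclideanSpace ℝ (Fin 21)),
    C.card = 27720 ∧ (∀ x ∈ C, ‖x‖ = 1) ∧ (∀ x ∈ C, ∀ y ∈ C, x ≠ y → inner ℝ x y ≤ 1 / 2) := by
  have hS : sec21 ⊆ leechInt := fun y hy => (mem_sec21 hy).1
  let u : Fin 3 → EuclideanSpace ℝ (Fin 24) := ![toE 32 x0, toE 32 w21a, toE 32 w21b]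
  have hu : LinearIndependent ℝ u := by
    apply linearIndependent_of_ne_zero_of_inner_eq_zero
    · intro i
      fin_cases i
      · exact toE_ne_zero (by rw [ip_x0_x0]; norm_num)
      · exact toE_ne_zero (by decide)
      · exact toE_ne_zero (by decide)
    · intro i j hij
      fin_cases i <;> fin_cases j
      · exact absurd rfl hij
      · exact inner_toE_eq_zero (by decide)
      · exact inner_toE_eq_zero (by decide)
      · exact inner_toE_eq_zero (by decide)
      · exact absurd rfl hij
      · exact inner_toE_eq_zero (by decide)
      · exact inner_toE_eq_zero (by decide)
      · exact inner_toE_eq_zero (by decide)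
      · exact absurd rfl hij
  have horth : ∀ x ∈ sec21.image (toE 32), ∀ i, inner ℝ (u i) x = 0 := by
    intro x hx i
    obtain ⟨y, hy, rfl⟩ := mem_image.mp hx
    obtain ⟨_, h01, h02, h03⟩ := mem_sec21 hy
    fin_cases i
    · exact inner_toE_eq_zero (by rw [ip_x0]; omega)
    · exact inner_toE_eq_zero (by rw [ip_w21a]; omega)
    · exact inner_toE_eq_zero (by rw [ip_w21b]; omega)
  obtain ⟨C', hc, hn, hi, _⟩ := exists_transfer_orthogonal (m := 24) (n := 21) (k := 3) rfl u hu
    (sec21.image (toE 32)) horth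
  obtain ⟨h1, h2, h3⟩ := kissing_of_transfer hS hc hn hi
  exact ⟨C', by rw [h1, card_sec21], h2, h3⟩

/-- **`27720 ≤ κ(21) ≤ 56851` in Lean.** [cite: ConwaySloane1999, Ch. 1 Table 1.2] -/
theorem kissing_dim21_bracket :
    (∃ C : Finset (EuclideanSpace ℝ (Fin 21)), C.card = 27720 ∧ (∀ x ∈ C, ‖x‖ = 1) ∧
      (∀ x ∈ C, ∀ y ∈ C, x ≠ y → inner ℝ x y ≤ 1 / 2)) ∧
    ∀ C : Finset (EuclideanSpace ℝ (Fin 21)), (∀ x ∈ C, ‖x‖ = 1) →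
      (∀ x ∈ C, ∀ y ∈ C, x ≠ y → inner ℝ x y ≤ 1 / 2) → C.card ≤ 56851 :=
  ⟨exists_kissing_27720, Kissing.kissing_dim21_le_56851⟩

end Summit.Ventures.PackingBounds.Config.Leech
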